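import Literature.AlgebraicGeometry.Motives.AbelianVarietyConjugateEtaleH1Transport
import Literature.AlgebraicGeometry.Motives.AbelianVarietyBaseChange
import Literature.AlgebraicGeometry.Motives.BaseChangeAlongInverse
import Literature.AlgebraicGeometry.Milne1999.CMTypeSimpleIsogenyFactors
import Literature.AlgebraicGeometry.ComplexMultiplication.TateModuleOfCMFreeRankOne
import HarnessLib

/-!
# Conjugation `A ↦ A^σ` versus isogenies, `End⁰` and the `ℓ`-adic representation

Topic `AlgebraicGeometry/Motives`; namespace `Literature.AlgebraicGeometry.Motives.AbelianVariety`.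
GENERIC bookkeeping for the conjugate `A^σ` of an abelian variety by a field automorphism `σ` (★ `AbelianVarietyConjugate`:
«the functor `σ`», [Milne2005ShimuraVarieties, §11 p. 108]; [Shimura1998, §18.6]):

* §1 `Hom.conjugate_nsmul`, `Hom.conjugate_comp_eq_nsmul_id`, **`IsIsogeny.conjugate`** — multiplication-by-`N` data and isogenies
  are preserved (`u ≫ v = [N] ⇒ u^σ ≫ v^σ = [N]`; surjective + finite are stable under base change, [GortzWedhorn2020,
  Prop. 4.32 (2), Prop. 12.11 (2)]);
* §2 `endAlgebra.mapRingHom_of`, `endAlgebra.mapRingHom_algebraMap_mul_of`, **`endAlgebraTransport_mapRingHom_endConjugate`** —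
  the transport of `End⁰` along an isogeny `u` with quasi-inverse `v` ([MumfordAV1970, §19 Remark (p. 172)], ★ `endAlgebraTransport`)
  commutes with `End⁰(σ) : End⁰(A) → End⁰(A^σ)` (★ `endAlgebra.mapRingHom (A.endConjugate σ)`);
* §3 **`conjTransportRatTateEquiv_rationalTateAction`** — the `ℓ`-adic action of `End⁰` ([SerreTate1968, §4]) is carried by the
  transport `H : V_ℓ A ≃ V_ℓ A^σ` (★ `conjTransportRatTateEquiv`) to the action of `End⁰(σ)(x)`; dual forms
  `conjTransportEtaleH1Equiv_symm_apply`, `conjTransportEtaleH1Equiv_symm_dualMap_rationalTateAction` (an eigen-linear-form for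
  `x` transports to an eigen-linear-form for `End⁰(σ)(x)` with the same eigenvalue — [Shimura1998, §18.6 proof of Thm. 18.6, p. 129]).

No new definitions; default heartbeats.
-/

open CategoryTheory
open scoped TensorProduct

namespace Literature.AlgebraicGeometry.Motives.AbelianVariety

universe u

/-! ## §1. Isogeny data under conjugation -/

section Isogeny

variable {L : Type u} [Field L] (σ : L ≃+* L) {X Y : AbelianVariety L}

/-- `(n • f)^σ = n • f^σ` (conjugation of homomorphisms is additive). [cite: Milne2005ShimuraVarieties, §11 p. 108 («the functor σ»)] -/
theorem Hom.conjugate_nsmul (n : ℕ) (f : X ⟶ Y) : Hom.conjugate σ (n • f) = n • Hom.conjugate σ f :=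
  map_nsmul (AddMonoidHom.mk' (fun g : X ⟶ Y => Hom.conjugate σ g) (Hom.conjugate_add σ)) n f

/-- `u ≫ v = [N]_X ⇒ u^σ ≫ v^σ = [N]_{X^σ}`. [cite: Milne2005ShimuraVarieties, §11 p. 108 («the functor σ»)] -/
theorem Hom.conjugate_comp_eq_nsmul_id {u : X ⟶ Y} {v : Y ⟶ X} {N : ℕ} (huv : u ≫ v = N • 𝟙 X) :
    Hom.conjugate σ u ≫ Hom.conjugate σ v = N • 𝟙 (X.conjugate σ) := by
  rw [← Hom.conjugate_comp, huv, Hom.conjugate_nsmul, Hom.conjugate_id]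

/-- **Isogenies stay isogenies under conjugation** (`u^σ` is the base change of `u` along `σ`; surjectivity and finiteness are
stable under base change). [cite: GortzWedhorn2020, Prop. 4.32 (2) and Prop. 12.11 (2)] [cite: Milne2005ShimuraVarieties, §11 p. 108] -/
theorem IsIsogeny.conjugate {u : X ⟶ Y} (hu : IsIsogeny u) : IsIsogeny (Hom.conjugate σ u) :=
  IsIsogeny.baseChange (K := L) (L := AlongHom L σ.toRingHom) hu

end Isogeny

/-! ## §2. `End⁰(σ)` and the transport of `End⁰` along an isogeny -/

section EndAlgebra

variable {L : Type u} [Field L] (σ : L ≃+* L) {X Y : AbelianVariety L}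

/-- `End⁰(e)(1 ⊗ G) = 1 ⊗ e G` for a ring homomorphism `e : End X → End Y`. [cite: MumfordAV1970, §19 («The structure of End⁰(X)»)] -/
theorem endAlgebra.mapRingHom_of (e : End X →+* End Y) (G : End X) :
    endAlgebra.mapRingHom e (endAlgebra.of X G) = endAlgebra.of Y (e G) :=
  endAlgebra.mapRingHom_tmul e 1 G

/-- `End⁰(e)(c · (1 ⊗ G)) = c · (1 ⊗ e G)`. [cite: MumfordAV1970, §19 («The structure of End⁰(X)»)] -/
theorem endAlgebra.mapRingHom_algebraMap_mul_of (e : End X →+* End Y) (c : ℚ) (G : End X) :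
    endAlgebra.mapRingHom e (algebraMap ℚ X.endAlgebra c * endAlgebra.of X G) =
      algebraMap ℚ Y.endAlgebra c * endAlgebra.of Y (e G) := by
  rw [map_mul, AlgHom.commutes, endAlgebra.mapRingHom_of]

/-- **The transport of `End⁰` along an isogeny commutes with conjugation**: for `u : X → Y`, `v : Y → X` with
`u ≫ v = [N]`, `v ≫ u = [N]`, one has `tr_{u^σ, v^σ} ∘ End⁰(σ) = End⁰(σ) ∘ tr_{u,v}` on `End⁰(X)` (both send `N'⁻¹ · (1 ⊗ G)` to
`(N N')⁻¹ · (1 ⊗ (v G u)^σ)`). [cite: MumfordAV1970, §19 Remark (p. 172)] [cite: Milne2005ShimuraVarieties, §11 p. 108 («σi(a) = σ(i(a))»)] -/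
theorem endAlgebraTransport_mapRingHom_endConjugate (u : X ⟶ Y) (v : Y ⟶ X) (N : ℕ) (hN : 0 < N)
    (huv : u ≫ v = N • 𝟙 X) (hvu : v ≫ u = N • 𝟙 Y)
    (huv' : Hom.conjugate σ u ≫ Hom.conjugate σ v = N • 𝟙 (X.conjugate σ))
    (hvu' : Hom.conjugate σ v ≫ Hom.conjugate σ u = N • 𝟙 (Y.conjugate σ)) (x : X.endAlgebra) :
    endAlgebraTransport (Hom.conjugate σ u) (Hom.conjugate σ v) N hN huv' hvu' (endAlgebra.mapRingHom (X.endConjugate σ) x) =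
      endAlgebra.mapRingHom (Y.endConjugate σ) (endAlgebraTransport u v N hN huv hvu x) := by
  obtain ⟨M, G, -, rfl⟩ := endAlgebra.exists_eq_algebraMap_mul_of x
  have hEC : endConj (Hom.conjugate σ u) (Hom.conjugate σ v) (X.endConjugate σ G) = Y.endConjugate σ (endConj u v G) := by
    rw [endConj_apply, endConj_apply, endConjugate_apply, endConjugate_apply]
    change _ = Hom.conjugate σ (v ≫ G ≫ u)
    rw [Hom.conjugate_comp, Hom.conjugate_comp]
  rw [endAlgebra.mapRingHom_algebraMap_mul_of, endAlgebraTransport_algebraMap_mul_of, endAlgebraTransport_algebraMap_mul_of,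
    endAlgebra.mapRingHom_algebraMap_mul_of, hEC]

end EndAlgebra

/-! ## §3. The `ℓ`-adic action of `End⁰` under the transport `H : V_ℓ A ≃ V_ℓ A^σ` -/

section Tate

variable {L : Type} [Field L] (γ : L ≃+* L) (σt : AlgebraicClosure L ≃+* AlgebraicClosure L)
  (hσa : ∀ a : L, σt (algebraMap L (AlgebraicClosure L) a) = algebraMap L (AlgebraicClosure L) (γ a))
  (X : AbelianVariety L) (ℓ : ℕ) [Fact ℓ.Prime]

/-- **`H (x · w) = End⁰(γ)(x) · H w`**: the transport `H : V_ℓ X ≃ V_ℓ X^γ` intertwines the `ℓ`-adic action of `End⁰(X)`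
with that of `End⁰(X^γ)` through `End⁰(γ)` (write `x = N⁻¹ · (1 ⊗ G)` and use ★ `conjTransportRatTateEquiv_rationalTateModuleMap`).
[cite: SerreTate1968, §4 (proof of Thm. 5)] [cite: Milne2005ShimuraVarieties, §11 p. 108] -/
theorem conjTransportRatTateEquiv_rationalTateAction (x : X.endAlgebra) (w : X.rationalTateModule ℓ) :
    conjTransportRatTateEquiv γ σt hσa X ℓ (rationalTateAction X ℓ x w) =
      rationalTateAction (X.conjugate γ) ℓ (endAlgebra.mapRingHom (X.endConjugate γ) x)
        (conjTransportRatTateEquiv γ σt hσa X ℓ w) := by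
  obtain ⟨M, G, -, rfl⟩ := endAlgebra.exists_eq_algebraMap_mul_of x
  rw [endAlgebra.mapRingHom_algebraMap_mul_of, map_mul, map_mul, rationalTateAction_algebraMap, rationalTateAction_algebraMap,
    rationalTateAction_of, rationalTateAction_of, Module.End.mul_apply, Module.End.mul_apply, Module.algebraMap_end_apply,
    Module.algebraMap_end_apply, map_smul, endConjugate_apply, conjTransportRatTateEquiv_rationalTateModuleMap hσa]

/-- Unfolding of the inverse dual transport: `(Hd_X)⁻¹ f₀ = f₀ ∘ H_X⁻¹`. [cite: SerreTate1968, §1] -/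
theorem conjTransportEtaleH1Equiv_symm_apply (f₀ : Module.Dual ℚ_[ℓ] (X.rationalTateModule ℓ))
    (w : (X.conjugate γ).rationalTateModule ℓ) :
    (conjTransportEtaleH1Equiv γ σt hσa X ℓ).symm f₀ w = f₀ ((conjTransportRatTateEquiv γ σt hσa X ℓ).symm w) :=
  rfl

/-- **Dual form** — eigen-linear-forms transport with the same eigenvalue: `Hd⁻¹ (ψ ∘ (x ·)) = (Hd⁻¹ ψ) ∘ (End⁰(γ)(x) ·)`.
[cite: SerreTate1968, §4 (proof of Thm. 5)] [cite: Shimura1998, §18.6 proof of Thm. 18.6, p. 129] -/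
theorem conjTransportEtaleH1Equiv_symm_dualMap_rationalTateAction (x : X.endAlgebra)
    (ψ : Module.Dual ℚ_[ℓ] (X.rationalTateModule ℓ)) :
    (conjTransportEtaleH1Equiv γ σt hσa X ℓ).symm ((rationalTateAction X ℓ x).dualMap ψ) =
      (rationalTateAction (X.conjugate γ) ℓ (endAlgebra.mapRingHom (X.endConjugate γ) x)).dualMap
        ((conjTransportEtaleH1Equiv γ σt hσa X ℓ).symm ψ) := by
  apply LinearMap.ext
  intro w
  rw [conjTransportEtaleH1Equiv_symm_apply, LinearMap.dualMap_apply, LinearMap.dualMap_apply,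
    conjTransportEtaleH1Equiv_symm_apply]
  congr 1
  rw [eq_comm, LinearEquiv.symm_apply_eq, conjTransportRatTateEquiv_rationalTateAction, LinearEquiv.apply_symm_apply]

end Tate

end Literature.AlgebraicGeometry.Motives.AbelianVariety
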